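import Summits.BirchSwinnertonDyer.BirchSwinnertonDyer.Theorems.EisensteinPrimesSelmerAcMultiplicativePlaceSign
import Summits.BirchSwinnertonDyer.BirchSwinnertonDyer.Theorems.KolyvaginRoadThreeRationalLiftSplitOfFixedTorsion
import Literature.NumberTheory.EllipticCurves.TateCurve.MultiplicativeTwistUnramifiedProofs
import Literature.NumberTheory.EllipticCurves.TateCurve.NumberFieldUniformizationTwisted
import Literature.NumberTheory.EllipticCurves.KodairaNeronUnramifiedInertiaProofs
import Literature.AnabelianGeometry.AbsoluteAnabelian.LocalResidueFixedFieldProofs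
import Literature.NumberTheory.GaloisRepresentations.LocalGaloisGroupFrobeniusProofs
import Mathlib.FieldTheory.KrullTopology
import Mathlib.FieldTheory.Galois.Infinite
import HarnessLib

/-!
# At a NON-split multiplicative place of an elliptic curve over a number field EVERY Frobenius moves `√γ`
# — the `K_w`-intrinsic discharge of the inputs `hT'`, `hI`, `hF` of `SelmerAcMultiplicativePlaceSign`

Cell `bsd-eis` (home `run/shared/lean/pub/bsd-eis/`), seat `bsd-line-x1-p1-w2` (D-0154 width seat on
crux 2 `GoodLatticeBDPValue` = stmt-BirchSwinnertonDyer-19032, line `halves`, `f`-side conjunct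
`rem142_goodLattice_selmerAc_imprimitive`; host RULING L110 / L112, the LEAD successor's tree pointers
of STATUS l.2574 adopted).  For an elliptic curve `W` over a number field `K` and a finite place `v` of
multiplicative reduction, `γ = −c₄/c₆`, `t ∈ K̄_v` with `t² = γ`:

* `inertia_fix_sqrt_gamma` — the inertia group of `K_v` fixes `t`, at EVERY finite place including
  `v ∣ 2`: the tree's theorem `TateCurve.toAlgEquiv_eq_of_mem_inertia_of_sq_eq_gamma` (Silverman
  *ATAEC* V Ex. 5.11), moved from `𝔐.inertia` to `absInertia K_v` by `inertia_eq_absInertia`;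
* `smul_eq_of_forall_absInertia_of_isFrobPow` — a point of `K̄_v` fixed by the inertia group and by
  ONE `φ` with `IsFrobPow φ 1` is fixed by all of `Γ_{K_v}` (its stabiliser is an open subgroup —
  Mathlib `stabilizer_isOpen_of_isIntegral` — containing `I` and `φ`, and `⋃ φ^j I` is dense:
  `exists_zpow_inv_mul_mem`);
* `toAlgEquiv_sqrt_gamma_ne_of_not_split` — hence at a NON-split `v` every such `φ` has `φ t ≠ t`:
  otherwise `t` is `Γ_{K_v}`-fixed, so `t ∈ K_v` (`InfiniteGalois.mem_range_algebraMap_iff_fixed`),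
  `γ = t²` is a square in `K_v`, and `W` is SPLIT at `v`
  (`Koly.RationalLift.hasSplitMultiplicativeReductionAt_of_isSquare_gamma`, Silverman V.5.3 (b)) —
  no parity condition, no `c₄, c₆ ∈ ℤ` shape, no Euler criterion;
* `exists_isFrobPow_one_apply_sqrt_gamma_ne` — the `hF` (`ε = −1`) hypothesis shape of p614431;
* `zpCorank_le_one_of_hasMultiplicativeReductionAt'`, `zpCorank_le_of_not_hasSplitMultiplicativeReductionAt`
  — p614431's per-place bounds with `hT'` (tree theorem
  `TateCurve.Silverman1994_thmV53_corV54_tateUniformisation_holds`), `hI`, `hF` ALL DISCHARGED: at a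
  non-split multiplicative `w ∤ p` of any elliptic `W/K`, any `ℤ_p`-extension `κ` (`p` odd), every
  subgroup `Y` of the image of `r_w` has `zpCorank Y p ≤ 𝟙[Nw ≡ −1 (mod p)]`, unconditionally.

HONEST FRAMING: tool theorems (no definition, no named fact introduced or assumed, no `sorry`); close
nothing by themselves (`--supports stmt-BirchSwinnertonDyer-19032`); BSD / Mazur's main conjecture is
proved for no curve.  With this file the side condition `h2` of the final sum
(`SelmerAcQuotientCorankLeCurveLocalLambda`, p616613) becomes removable — the sequel.

References: Silverman *ATAEC* V.5.3 (b), Ex. 5.11; Serre *Local Fields* XIII §4; Tate (Corvallis) §1.4;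
Greenberg–Vatsal 2000 §2 Prop. (2.4), pp. 14–15.
-/

-- `Summit.BirchSwinnertonDyer.BirchSwinnertonDyer.…`: summit and sub-problem share a name (D-0017 layout).
set_option linter.dupNamespace false
set_option autoImplicit false

noncomputable section

open scoped Classical AddSubgroup

open CategoryTheory Function NumberField IsDedekindDomain Field ValuativeRel
open Literature.NumberTheory.EllipticCurves Literature.NumberTheory.EllipticCurves.GreenbergSelmer
  Literature.NumberTheory.GaloisRepresentations
  Literature.NumberTheory.GaloisRepresentations.IsNonarchimedeanLocalField
  IsDedekindDomain.HeightOneSpectrum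
  Summit.BirchSwinnertonDyer.Rank1Residual Summit.BirchSwinnertonDyer.Rank1Residual.X2
  Summit.BirchSwinnertonDyer.Rank1Residual.X2.NonPrimitiveQuotientCorank
  Summit.BirchSwinnertonDyer.Rank1Residual.X11b.Three

namespace Summit.BirchSwinnertonDyer.BirchSwinnertonDyer.Theorems.SqrtGammaNonsplitFrobenius

variable {K : Type} [Field K] [NumberField K]

section Local

variable {v : HeightOneSpectrum (𝓞 K)}

/-- **A point of `K̄_v` fixed by the inertia group and by one Frobenius is fixed by all of `Γ_{K_v}`**:
its stabiliser is an open subgroup (Mathlib `stabilizer_isOpen_of_isIntegral`) containing `I_{K_v}`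
and `φ`, and the cosets `φ^j I_{K_v}` are dense (`exists_zpow_inv_mul_mem`).
[cite: SerreLocalFields1979, Ch. XIII §4] [cite: TateCorvallis1979, §1.4 (1.4.1)] -/
theorem smul_eq_of_forall_absInertia_of_isFrobPow {t : AlgebraicClosure (v.adicCompletion K)}
    (hI : ∀ σ ∈ absInertia (v.adicCompletion K), σ • t = t)
    {φ : absoluteGaloisGroup (v.adicCompletion K)} (hφ : IsFrobPow φ 1) (hφt : φ • t = t)
    (g : absoluteGaloisGroup (v.adicCompletion K)) : g • t = t := by
  have hopen : IsOpen ((MulAction.stabilizer (absoluteGaloisGroup (v.adicCompletion K)) t :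
      Subgroup (absoluteGaloisGroup (v.adicCompletion K))) : Set (absoluteGaloisGroup (v.adicCompletion K))) :=
    stabilizer_isOpen_of_isIntegral (K := v.adicCompletion K) (L := AlgebraicClosure (v.adicCompletion K)) t
  have hIle : absInertia (v.adicCompletion K) ≤
      MulAction.stabilizer (absoluteGaloisGroup (v.adicCompletion K)) t := fun σ hσ ↦ hI σ hσ
  obtain ⟨j, hj⟩ := exists_zpow_inv_mul_mem hIle hopen hφ g
  have hφs : φ ∈ MulAction.stabilizer (absoluteGaloisGroup (v.adicCompletion K)) t := hφt
  have hg : g ∈ MulAction.stabilizer (absoluteGaloisGroup (v.adicCompletion K)) t := by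
    have h := (MulAction.stabilizer (absoluteGaloisGroup (v.adicCompletion K)) t).mul_mem
      ((MulAction.stabilizer (absoluteGaloisGroup (v.adicCompletion K)) t).zpow_mem hφs j) hj
    rwa [mul_inv_cancel_left] at h
  exact hg

/-- **Inertia fixes `√γ` at every multiplicative place** (`hI` of `SelmerAcMultiplicativePlaceSign`,
any number field, any finite place including `v ∣ 2`): the tree's theorem
`TateCurve.toAlgEquiv_eq_of_mem_inertia_of_sq_eq_gamma`, with `𝔐.inertia Γ_{K_v} = absInertia K_v`
(`inertia_eq_absInertia`). [cite: SilvermanATAEC1994, Ch. V Thm. 5.3 (b) and Ex. 5.11 (PDF pp. 407–412)] -/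
theorem inertia_fix_sqrt_gamma (W : WeierstrassCurve K) [W.IsElliptic]
    (hmult : W.HasMultiplicativeReductionAt v) :
    ∀ t : AlgebraicClosure (v.adicCompletion K),
      t ^ 2 = algebraMap (v.adicCompletion K) (AlgebraicClosure (v.adicCompletion K))
        (algebraMap K (v.adicCompletion K) (-(W.c₄ / W.c₆))) →
      ∀ σ ∈ absInertia (v.adicCompletion K),
        Field.absoluteGaloisGroup.toAlgEquiv (v.adicCompletion K) σ t = t := by
  intro t ht σ hσ
  obtain ⟨w, hw⟩ := v.exists_spectralValuation
  obtain ⟨𝔐, h𝔐⟩ := v.localPrimesAbove_nonempty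
  rw [← inertia_eq_absInertia hw h𝔐] at hσ
  exact TateCurve.toAlgEquiv_eq_of_mem_inertia_of_sq_eq_gamma W hmult h𝔐 ht hσ

/-- **At a NON-split multiplicative place every Frobenius moves `√γ`**: for `φ ∈ Γ_{K_v}` with
`IsFrobPow φ 1` and `t² = γ`, `φ t ≠ t`.  Otherwise `t` is fixed by inertia
(`inertia_fix_sqrt_gamma`) and by `φ`, hence by all of `Γ_{K_v}`
(`smul_eq_of_forall_absInertia_of_isFrobPow`), so `t ∈ K_v`
(`InfiniteGalois.mem_range_algebraMap_iff_fixed`), `γ = t²` is a square in `K_v`, and `W` is split at `v`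
(`Koly.RationalLift.hasSplitMultiplicativeReductionAt_of_isSquare_gamma`, Silverman V.5.3 (b)).
[cite: SilvermanATAEC1994, Ch. V Thm. 5.3 (b)] [cite: GreenbergVatsal2000, §2 pp. 14–15] -/
theorem toAlgEquiv_sqrt_gamma_ne_of_not_split (W : WeierstrassCurve K) [W.IsElliptic]
    (hmult : W.HasMultiplicativeReductionAt v) (hns : ¬ W.HasSplitMultiplicativeReductionAt v)
    {φ : absoluteGaloisGroup (v.adicCompletion K)} (hφ : IsFrobPow φ 1)
    {t : AlgebraicClosure (v.adicCompletion K)}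
    (ht : t ^ 2 = algebraMap (v.adicCompletion K) (AlgebraicClosure (v.adicCompletion K))
        (algebraMap K (v.adicCompletion K) (-(W.c₄ / W.c₆)))) :
    Field.absoluteGaloisGroup.toAlgEquiv (v.adicCompletion K) φ t ≠ t := by
  intro hφt
  apply hns
  haveI : IsGalois (v.adicCompletion K) (AlgebraicClosure (v.adicCompletion K)) :=
    isGalois_algebraicClosure_adicCompletion (K := K) (v := v)
  have hI := inertia_fix_sqrt_gamma W hmult t ht
  have hfix : ∀ g : absoluteGaloisGroup (v.adicCompletion K), g • t = t :=
    smul_eq_of_forall_absInertia_of_isFrobPow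
      (fun σ hσ ↦ by rw [Field.absoluteGaloisGroup.smul_def]; exact hI σ hσ) hφ
      (by rw [Field.absoluteGaloisGroup.smul_def]; exact hφt)
  obtain ⟨s, hs⟩ := (InfiniteGalois.mem_range_algebraMap_iff_fixed t).mpr (fun f ↦ hfix f)
  refine Koly.RationalLift.hasSplitMultiplicativeReductionAt_of_isSquare_gamma W v hmult ⟨s, ?_⟩
  apply (algebraMap (v.adicCompletion K) (AlgebraicClosure (v.adicCompletion K))).injective
  rw [map_mul, hs, ← sq, ht]

/-- **`hF` (`ε = −1`) of `SelmerAcMultiplicativePlaceSign` at a non-split place, DISCHARGED**: some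
`φ` with `IsFrobPow φ 1` (they exist, `exists_isFrobPow_holds`) moves every square root of `γ`.
[cite: GreenbergVatsal2000, §2 pp. 14–15] -/
theorem exists_isFrobPow_one_apply_sqrt_gamma_ne (W : WeierstrassCurve K) [W.IsElliptic]
    (hmult : W.HasMultiplicativeReductionAt v) (hns : ¬ W.HasSplitMultiplicativeReductionAt v) :
    ∀ t : AlgebraicClosure (v.adicCompletion K), t ≠ 0 →
      t ^ 2 = algebraMap (v.adicCompletion K) (AlgebraicClosure (v.adicCompletion K))
        (algebraMap K (v.adicCompletion K) (-(W.c₄ / W.c₆))) →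
      ∃ φ : absoluteGaloisGroup (v.adicCompletion K), IsFrobPow φ 1 ∧
        Field.absoluteGaloisGroup.toAlgEquiv (v.adicCompletion K) φ t ≠ t := by
  intro t _ ht
  obtain ⟨φ, hφ⟩ := exists_isFrobPow_holds (F := v.adicCompletion K) 1
  exact ⟨φ, hφ, toAlgEquiv_sqrt_gamma_ne_of_not_split W hmult hns hφ ht⟩

end Local

/-! ## The per-place bounds of p614431 with `hT'`, `hI`, `hF` discharged -/

section Bounds

variable {p : ℕ} [hp : Fact p.Prime]

/-- **`zpCorank Y ≤ 1` at ANY multiplicative `w ∤ p`, unconditionally** (p614431's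
`zpCorank_le_one_of_hasMultiplicativeReductionAt` with the twisted Tate uniformisation taken from the
tree's `TateCurve.Silverman1994_thmV53_corV54_tateUniformisation_holds` and `hI` from
`inertia_fix_sqrt_gamma`). [cite: GreenbergVatsal2000, §2 Prop. (2.4) pp. 22–23] -/
theorem zpCorank_le_one_of_hasMultiplicativeReductionAt' (W : WeierstrassCurve K) [W.IsElliptic]
    (κ : ZpExtension K p) {w : HeightOneSpectrum (𝓞 K)}
    (hpw : ((p : ℕ) : 𝓞 K) ∉ w.asIdeal) (hmult : W.HasMultiplicativeReductionAt w)
    (Y : AddSubgroup (discreteH1 (inertiaIn κ.kerSubgroup w) (W.geomPrimaryTorsion p))) :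
    zpCorank Y p ≤ 1 :=
  SelmerAcMultiplicativePlaceSign.zpCorank_le_one_of_hasMultiplicativeReductionAt
    TateCurve.Silverman1994_thmV53_corV54_tateUniformisation_holds W κ hpw hmult
    (inertia_fix_sqrt_gamma W hmult) Y

/-- **At a NON-split multiplicative `w ∤ p` of ANY elliptic curve over ANY number field, every subgroup
`Y` of the image of `r_w : H¹(K_∞, E[p^∞]) → H¹(I_w(K_∞), E[p^∞])` has
`zpCorank Y p ≤ 𝟙[Nw ≡ −1 (mod p)]`, UNCONDITIONALLY** (`p` odd, any `ℤ_p`-extension `κ`): p614431's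
`zpCorank_le_of_frob_flips_sqrt_gamma` with `hT'`, `hI`, `hF` discharged by the tree's Tate
uniformisation, `inertia_fix_sqrt_gamma` and `exists_isFrobPow_one_apply_sqrt_gamma_ne`.  Greenberg–Vatsal
Prop. (2.4) (`d_ℓ = 𝟙[ℓ ≡ a_ℓ]`, `a_ℓ = −1`) per place of `K_∞`, over a number field, including `w ∣ 2`.
[cite: GreenbergVatsal2000, §2 Prop. (2.4) pp. 22–23 and pp. 14–15]
[cite: SilvermanATAEC1994, Ch. V Lemma 5.2 (c), Thm. 5.3 (a),(b), Cor. 5.4 (held copy PDF pp. 406–410)] -/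
theorem zpCorank_le_of_not_hasSplitMultiplicativeReductionAt (W : WeierstrassCurve K) [W.IsElliptic]
    (hp2 : p ≠ 2) (κ : ZpExtension K p) {w : HeightOneSpectrum (𝓞 K)}
    (hpw : ((p : ℕ) : 𝓞 K) ∉ w.asIdeal) (hmult : W.HasMultiplicativeReductionAt w)
    (hns : ¬ W.HasSplitMultiplicativeReductionAt w)
    (Y : AddSubgroup (discreteH1 (inertiaIn κ.kerSubgroup w) (W.geomPrimaryTorsion p)))
    (hY : ∀ y ∈ Y, ∃ c : subgroupH1 κ.kerSubgroup (W.geomPrimaryTorsion p),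
      resH1Hom (inertiaInToH κ.kerSubgroup w) (AddMonoidHom.id (W.geomPrimaryTorsion p))
        (fun _ _ ↦ rfl) c = y) :
    zpCorank Y p ≤ if (w.asIdeal.absNorm : ZMod p) = -1 then 1 else 0 :=
  SelmerAcMultiplicativePlaceSign.zpCorank_le_of_frob_flips_sqrt_gamma
    TateCurve.Silverman1994_thmV53_corV54_tateUniformisation_holds W hp2 κ hpw hmult
    (inertia_fix_sqrt_gamma W hmult) (exists_isFrobPow_one_apply_sqrt_gamma_ne W hmult hns) Y hY

end Bounds

end Summit.BirchSwinnertonDyer.BirchSwinnertonDyer.Theorems.SqrtGammaNonsplitFrobenius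

end
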